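import Summits.CriticalPhenomena.SAWScalingLimit.Theses.SAWConePseudogroup
import Literature.Probability.RandomPlanarGeometry.ConformalRestrictionProofs

/-!
# Route `SAWConePseudogroup`, support item `CovarianceUpgrade` (stmt-CriticalPhenomena-7307)

Landing target:
`Summits/CriticalPhenomena/SAWScalingLimit/Theorems/SAWConePseudogroupCovarianceUpgrade.lean`
(`--workitem stmt-CriticalPhenomena-7307`).

The glue step of the route: endpoint approximations exist → `PowerMapUniversality` →
`PseudogroupDensity` → every chordal full scaling limit `P` of the critical `δℤ²` SAW laws that is
covariant under the lattice similarities and sequentially continuous along conformal images is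
conformally covariant.

Proof (pure bookkeeping, Billingsley 1999 Thm 1.2: a finite Borel measure on a metric space is
determined by the integrals of bounded continuous functions). `PseudogroupDensity` asks for three
hypotheses; two are given, and the third — covariance under the single power map,
`P D' = Φ_* (P D)` for `D ⋐ S`, `D' = Φ(D)` with image marks and `Φ = z^{4/3}` on `S` — follows
from the lattice: pick endpoint approximations `(a_δ, b_δ)` of `D` and `(a'_δ, b'_δ)` of `D'`;
for a bounded continuous `f`, `f ∘ CurveClass.map Φ` is bounded continuous
(`CurveClass.continuous_map`), so (lim) at `D` gives `∫ f (Φ ∘ γ) d law_{D,δ} → ∫ f ∘ map Φ dP D`,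
(lim) at `D'` gives `∫ f(γ) d law_{D',δ} → ∫ f dP D'`, and `PowerMapUniversality` says the
difference of the two left-hand sides tends to `0`; by uniqueness of limits along the proper
filter `𝓝[>] 0`, `∫ f d(Φ_* P D) = ∫ f ∘ map Φ dP D = ∫ f dP D'` for every `f`, whence
`P D' = Φ_* P D` (`MeasureTheory.ext_of_forall_integral_eq_of_IsFiniteMeasure`; both sides are
probability measures since `P` is chordal and `CurveClass.map Φ` is Borel).

Sources: P. Billingsley, *Convergence of probability measures*, 2nd ed. (1999), Thm 1.2;
G. F. Lawler, O. Schramm, W. Werner, *On the scaling limit of planar self-avoiding walk* (2004),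
§2 (conformal invariance of `m#`). Tagged [folklore].
-/

noncomputable section

namespace Summit.CriticalPhenomena.SAWScalingLimit.Theorems

open MeasureTheory Filter Topology Set
open scoped NNReal
open Literature.Probability.RandomPlanarGeometry
open Literature.Probability.LatticeModels (Site)
open Summit.CriticalPhenomena.SAWScalingLimit.Theses

/-- **Uniqueness of weak limits, difference form.** If `∫ g d law_δ → A`, `∫ f d law'_δ → B`
and the difference of the two integrals tends to `0` along `𝓝[>] 0`, then `A = B`
(Billingsley 1999, Thm 1.2, in the form the route's glue needs). [folklore] -/
theorem covarianceUpgrade_eq_of_tendsto_sub {u v : ℝ → ℝ} {A B : ℝ}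
    (hu : Tendsto u (𝓝[>] (0 : ℝ)) (𝓝 A)) (hv : Tendsto v (𝓝[>] (0 : ℝ)) (𝓝 B))
    (huv : Tendsto (fun δ => u δ - v δ) (𝓝[>] (0 : ℝ)) (𝓝 0)) : A = B := by
  have h : Tendsto (fun δ => u δ - v δ) (𝓝[>] (0 : ℝ)) (𝓝 (A - B)) := hu.sub hv
  exact sub_eq_zero.1 (tendsto_nhds_unique h huv)

/-- **Power-map covariance of the limit from power-map universality on the lattice.** If every
Dobrushin domain admits an endpoint approximation, `PowerMapUniversality` holds, and the chordal
family `P` is the full scaling limit of the critical `δℤ²` SAW laws, then for `D ⋐ S`,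
`D' = Φ(D)` with image marks and `Φ = z^{4/3}` on `S`: `P D' = Φ_* (P D)`.
(Billingsley 1999 Thm 1.2: bounded continuous integrals determine a finite Borel measure on a
metric space.) [folklore] -/
theorem covarianceUpgrade_powerMap_covariance
    (hEnd : ∀ D : DobrushinDomain, ∃ a b : ℝ → Site 2, SAW.IsEndpointApprox D a b)
    (hPow : SAWConePseudogroup.PowerMapUniversality)
    (P : ChordalFamily) (hch : P.IsChordal)
    (hlim : ∀ (D : DobrushinDomain) (a b : ℝ → Site 2), SAW.IsEndpointApprox D a b →
      TendstoLaw (fun δ (γ : SAW.DomainSAW D.carrier δ (a δ) (b δ)) => γ.curve)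
        (fun δ => SAW.law D.carrier δ (a δ) (b δ)) id (P D))
    (D D' : DobrushinDomain) (Φ : C(ℂ, ℂ))
    (hcl : closure D.carrier ⊆ {z : ℂ | z ≠ 0 ∧ |Complex.arg z| < 3 * Real.pi / 4})
    (hEq : Set.EqOn Φ (fun z : ℂ => z ^ ((4 : ℂ) / 3))
      {z : ℂ | z ≠ 0 ∧ |Complex.arg z| < 3 * Real.pi / 4})
    (hcar : D'.carrier = Φ '' D.carrier) (h0 : D'.pt 0 = Φ (D.pt 0)) (h1 : D'.pt 1 = Φ (D.pt 1)) :
    P D' = (P D).map (CurveClass.map Φ) := by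
  obtain ⟨a, b, hab⟩ := hEnd D
  obtain ⟨a', b', hab'⟩ := hEnd D'
  haveI : IsProbabilityMeasure (P D) := (hch D).1
  haveI : IsProbabilityMeasure (P D') := (hch D').1
  have hΦm : Measurable (CurveClass.map Φ) := CurveClass.measurable_map Φ
  haveI : IsProbabilityMeasure ((P D).map (CurveClass.map Φ)) :=
    Measure.isProbabilityMeasure_map hΦm.aemeasurable
  refine ext_of_forall_integral_eq_of_IsFiniteMeasure fun f => ?_
  rw [integral_map hΦm.aemeasurable f.continuous.aestronglyMeasurable]
  -- the composed test function `f ∘ CurveClass.map Φ`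
  set g : BoundedContinuousFunction (CurveClass ℂ) ℝ :=
    f.compContinuous ⟨CurveClass.map Φ, CurveClass.continuous_map Φ⟩ with hg
  have hu := hlim D a b hab g
  have hv := hlim D' a' b' hab' f
  have huv := hPow D D' Φ hcl hEq hcar h0 h1 a b a' b' hab hab' f
  have key := covarianceUpgrade_eq_of_tendsto_sub hu hv (by simpa [hg] using huv)
  simpa [hg] using key.symm

/-- **Item `CovarianceUpgrade` (stmt-CriticalPhenomena-7307) of route `SAWConePseudogroup`.**
Endpoint approximations exist → `PowerMapUniversality` → `PseudogroupDensity` → every chordal full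
scaling limit `P` of the critical `δℤ²` SAW laws with lattice-similarity covariance and sequential
continuity along conformal images is conformally covariant: feed `PseudogroupDensity` the given
similarity covariance and continuity, and the power-map covariance obtained from the lattice by
`covarianceUpgrade_powerMap_covariance`. [folklore] -/
theorem covarianceUpgrade_proof : SAWConePseudogroup.CovarianceUpgrade := by
  intro hEnd hPow hDens P hch hlim hSim hCont
  exact hDens P hch hSim
    (fun D D' Φ hcl hEq hcar h0 h1 =>
      covarianceUpgrade_powerMap_covariance hEnd hPow P hch hlim D D' Φ hcl hEq hcar h0 h1)
    hCont

end Summit.CriticalPhenomena.SAWScalingLimit.Theorems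

end
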